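import Summits.ABC.ABC.Theses.IneffectiveSubspace
import Summits.ABC.ABC.Theorems.IneffectiveSubspaceTowerFourSubLiouvilleStubFixedFormsRoth

/-!
# Fourth-power divisors of `x² − 1`, II: the Roth stratum (bounded cofactors) — `T(x² − 1) = o(√x)`

Calibration lemmas of line `SketchIdeator5` for crux #2 `UniformSadicTowerFour` (stmt-ABC-14937) of route
`IneffectiveSubspace`, continued (see `IneffectiveSubspaceUniformSadicTowerFourFourthPowerDivisor.lean` for
`ConjP := ∀ ε > 0 ∃ C ∀ x ≥ 2 ∀ t, t⁴ ∣ x² − 1 → t ≤ C·x^(1/3+ε)`, a consequence of the crux, trivial with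
exponent `1/2`).  `Cruxes/UniformSadicTowerFour/StructureNotes-r2-k5.md` §5(e) locates the content of any
saving below `1/2` in the coprime splittings `x − 1 = m₁t₁⁴`, `x + 1 = m₂t₂⁴` with SMALL cofactors
`m₁, m₂`, i.e. in the binomial quartic Thue family `m₂t₂⁴ − m₁t₁⁴ = 2` (or `= 1` after halving, `x` odd),
and states that only a bound UNIFORM (polynomial) in `m₁m₂` would give a saving.  This file kernel-checks the
complementary, non-uniform statement that IS a theorem — Thue–Siegel–Roth, form by form, via the tree's
PROVED `roth_holds` as packaged in the landed `TowerFourSubLiouville.fixedFormsRoth_pair`: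

* `binomialQuartic_bounded_pair` / `binomialQuartic_bounded_box` — for fixed `m₁, m₂ ≥ 1` (resp. a finite
  box `m₁, m₂, g ≤ B`) the solutions of `m₁t₁⁴ + g = m₂t₂⁴`, `g ≥ 1`, have `t₂` bounded (ineffectively);
* `exists_fourthPow_split` — a fourth power dividing a product of coprime numbers splits as a product of
  fourth powers dividing the factors;
* `fourthPowerDivisor_cofactor_unbounded_even` / `_odd` / `fourthPowerDivisor_cofactor_unbounded` — hence a
  fourth-power divisor `t⁴ ∣ x² − 1` (`x ≥ 2`) with cofactor `(x² − 1)/t⁴ ≤ B` forces `x ≤ X₀(B)` (even `x`: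
  `x − 1`, `x + 1` coprime, gap `2`; odd `x`: `(x − 1)/2`, `(x + 1)/2` coprime, gap `1`, the `2`-part of `t`
  absorbed into the cofactor bound `4B`): along every infinite family the cofactor of the largest
  fourth-power divisor of `x² − 1` tends to infinity, i.e. `T(x² − 1)⁴ = o(x²)` — Roth improves the trivial
  `T(x² − 1) < √x` to `o(√x)`, ineffectively and with no rate; `ConjP` asks for the rate `x^(1/3+ε)`.

Sources: K. F. Roth, *Rational approximations to algebraic numbers*, Mathematika 2 (1955) [Roth1955]
(through `Literature.NumberTheory.DiophantineGeometry.roth_holds`, proved in the tree).  No unproved facts.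
-/

-- `Summit.<Summit>.<Problem>` is the mandated summit-side namespace (CONVENTIONS §2); for the
-- single-conjunct summit `ABC` the two coincide, so the duplicate `ABC.ABC` is deliberate.
set_option linter.dupNamespace false

namespace Summit.ABC.ABC.Theorems.UniformSadicTowerFour.FourthPowerDivisor

open Summit.ABC.ABC.Theorems.TowerFourSubLiouville (fixedFormsRoth_pair)

/-- **One coefficient pair (Thue–Siegel–Roth).** For fixed `m₁, m₂ ≥ 1` there is an (ineffective) `N`
such that every solution of `m₁·t₁⁴ + g = m₂·t₂⁴` with `g ≥ 1` has `t₂ ≤ max N g`: by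
`fixedFormsRoth_pair` with saving `η = 1`, `t₂ < |m₂t₂⁴ − m₁t₁⁴| = g` once `t₂ ≥ Z₀(m₁, m₂)`.
[cite: Roth1955] -/
theorem binomialQuartic_bounded_pair {m₁ m₂ : ℕ} (hm₁ : 0 < m₁) (hm₂ : 0 < m₂) :
    ∃ N : ℕ, ∀ g t₁ t₂ : ℕ, 0 < g → m₁ * t₁ ^ 4 + g = m₂ * t₂ ^ 4 → t₂ ≤ max N g := by
  obtain ⟨Z₀, hZ⟩ := fixedFormsRoth_pair (η := 1) (by norm_num) hm₁ hm₂
  refine ⟨Z₀, fun g t₁ t₂ hg h => ?_⟩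
  by_contra hlt
  push Not at hlt
  have hZ0 : Z₀ ≤ t₂ := ((le_max_left _ _).trans_lt hlt).le
  have hgt : g < t₂ := (le_max_right _ _).trans_lt hlt
  have hne : m₂ * t₂ ^ 4 ≠ m₁ * t₁ ^ 4 := by
    intro he; omega
  have key := hZ t₁ t₂ hZ0 hne
  rw [Real.rpow_one] at key
  have hdiff : ((m₂ * t₂ ^ 4 : ℕ) : ℝ) - ((m₁ * t₁ ^ 4 : ℕ) : ℝ) = g := by
    have hc : ((m₁ * t₁ ^ 4 + g : ℕ) : ℝ) = ((m₂ * t₂ ^ 4 : ℕ) : ℝ) := by exact_mod_cast h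
    push_cast at hc ⊢
    linarith
  rw [hdiff, Nat.abs_cast] at key
  have : t₂ < g := by exact_mod_cast key
  omega

/-- **A finite box of coefficients and right-hand sides.** For every `B` there is an (ineffective) `N(B)`
such that every solution of `m₁·t₁⁴ + g = m₂·t₂⁴` with `m₁, m₂ ≤ B` and `1 ≤ g ≤ B` has `t₂ ≤ N`
(`m₁ = 0` is harmless: then `t₂ ≤ t₂⁴ ≤ g`).  Maximum of the thresholds of `binomialQuartic_bounded_pair`
over the box. [cite: Roth1955] -/
theorem binomialQuartic_bounded_box (B : ℕ) :
    ∃ N : ℕ, ∀ m₁ m₂ g t₁ t₂ : ℕ, m₁ ≤ B → m₂ ≤ B → 0 < g → g ≤ B →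
      m₁ * t₁ ^ 4 + g = m₂ * t₂ ^ 4 → t₂ ≤ N := by
  have hpair : ∀ m₁ m₂ : ℕ, ∃ N : ℕ, ∀ g t₁ t₂ : ℕ, 0 < m₁ → 0 < m₂ → 0 < g →
      m₁ * t₁ ^ 4 + g = m₂ * t₂ ^ 4 → t₂ ≤ max N g := by
    intro m₁ m₂
    rcases Nat.eq_zero_or_pos m₁ with h1 | h1
    · exact ⟨0, fun _ _ _ h _ _ _ => absurd h (by omega)⟩
    rcases Nat.eq_zero_or_pos m₂ with h2 | h2
    · exact ⟨0, fun _ _ _ _ h _ _ => absurd h (by omega)⟩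
    obtain ⟨N, hN⟩ := binomialQuartic_bounded_pair h1 h2
    exact ⟨N, fun g t₁ t₂ _ _ hg h => hN g t₁ t₂ hg h⟩
  choose f hf using hpair
  refine ⟨B + (Finset.range (B + 1) ×ˢ Finset.range (B + 1)).sup (fun q => f q.1 q.2), ?_⟩
  intro m₁ m₂ g t₁ t₂ hm₁ hm₂ hg hgB h
  have h2 : 0 < m₂ := by
    rcases Nat.eq_zero_or_pos m₂ with h2 | h2
    · rw [h2, zero_mul] at h; omega
    · exact h2
  rcases Nat.eq_zero_or_pos m₁ with h1 | h1
  · rw [h1, zero_mul, zero_add] at h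
    have h4 : t₂ ≤ t₂ ^ 4 := Nat.le_self_pow (by norm_num) _
    have h5 : t₂ ^ 4 ≤ m₂ * t₂ ^ 4 := Nat.le_mul_of_pos_left _ h2
    omega
  · have hmem : (m₁, m₂) ∈ Finset.range (B + 1) ×ˢ Finset.range (B + 1) := by
      rw [Finset.mem_product, Finset.mem_range, Finset.mem_range]; omega
    have hfle : f m₁ m₂ ≤ (Finset.range (B + 1) ×ˢ Finset.range (B + 1)).sup (fun q => f q.1 q.2) :=
      Finset.le_sup (f := fun q : ℕ × ℕ => f q.1 q.2) hmem
    have := hf m₁ m₂ g t₁ t₂ h1 h2 hg h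
    rcases le_max_iff.mp this with h' | h' <;> omega

/-- **Splitting a fourth power across coprime factors.** If `gcd(a, b) = 1` and `t⁴ ∣ a·b` then
`t = t₁·t₂` with `t₁⁴ ∣ a` and `t₂⁴ ∣ b` (`Nat.dvd_mul` gives coprime `k₁ ∣ a`, `k₂ ∣ b` with
`k₁k₂ = t⁴`, and coprime factors of a fourth power are fourth powers). [folklore] -/
theorem exists_fourthPow_split {a b t : ℕ} (hab : Nat.Coprime a b) (h : t ^ 4 ∣ a * b) :
    ∃ t₁ t₂ : ℕ, t = t₁ * t₂ ∧ t₁ ^ 4 ∣ a ∧ t₂ ^ 4 ∣ b := by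
  obtain ⟨k₁, k₂, hk₁, hk₂, hk⟩ := Nat.dvd_mul.mp h
  have hcop : Nat.Coprime k₁ k₂ :=
    Nat.Coprime.coprime_dvd_right hk₂ (Nat.Coprime.coprime_dvd_left hk₁ hab)
  have hu : IsUnit (gcd k₁ k₂) := by rw [Nat.isUnit_iff]; exact hcop
  have hu' : IsUnit (gcd k₂ k₁) := by rw [Nat.isUnit_iff]; exact hcop.symm
  obtain ⟨t₁, ht₁⟩ := exists_eq_pow_of_mul_eq_pow hu hk
  obtain ⟨t₂, ht₂⟩ := exists_eq_pow_of_mul_eq_pow hu' ((mul_comm k₂ k₁).trans hk)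
  refine ⟨t₁, t₂, ?_, ht₁ ▸ hk₁, ht₂ ▸ hk₂⟩
  have h4 : t ^ 4 = (t₁ * t₂) ^ 4 := by rw [mul_pow, ← ht₁, ← ht₂, hk]
  exact Nat.pow_left_injective (by norm_num) h4

/-- **`T(x² − 1) = o(√x)` on even `x` (Roth stratum of `ConjP`).** For every `B` there is an (ineffective)
`X₀(B)` such that for every EVEN `x ≥ 2` and every `t` with `t⁴ ∣ x² − 1` and cofactor `(x² − 1)/t⁴ ≤ B`
one has `x ≤ X₀`.  Proof: `x − 1`, `x + 1` are coprime (odd, difference `2`), so `t = t₁t₂`,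
`x − 1 = m₁t₁⁴`, `x + 1 = m₂t₂⁴` (`exists_fourthPow_split`) with `m₁m₂ = (x² − 1)/t⁴ ≤ B`, and
`m₁t₁⁴ + 2 = m₂t₂⁴` has `t₂ ≤ N(max B 2)` by `binomialQuartic_bounded_box`; then `x + 1 = m₂t₂⁴ ≤ B·N⁴`.
So along any infinite family of even `x` the cofactor of the largest fourth-power divisor of `x² − 1` tends to
infinity; `ConjP` (exponent `1/3`) is the quantitative form that no known theorem reaches. [cite: Roth1955] -/
theorem fourthPowerDivisor_cofactor_unbounded_even (B : ℕ) :
    ∃ X₀ : ℕ, ∀ x t : ℕ, Even x → 2 ≤ x → t ^ 4 ∣ x ^ 2 - 1 → (x ^ 2 - 1) / t ^ 4 ≤ B → x ≤ X₀ := by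
  obtain ⟨N, hN⟩ := binomialQuartic_bounded_box (max B 2)
  refine ⟨max B 2 * N ^ 4, fun x t hx h2 hdvd hcof => ?_⟩
  -- `x² − 1 = (x − 1)(x + 1)` with coprime odd factors
  have hfac : x ^ 2 - 1 = (x - 1) * (x + 1) := by
    rw [show x ^ 2 - 1 = x ^ 2 - 1 ^ 2 by rw [one_pow], Nat.sq_sub_sq, mul_comm]
  have hodd1 : Odd (x - 1) := by
    obtain ⟨k, hk⟩ := hx; exact ⟨k - 1, by omega⟩
  have hcop : Nat.Coprime (x - 1) (x + 1) := by
    have h : Nat.Coprime (x - 1) ((x - 1) + 2) := by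
      rw [Nat.coprime_self_add_right]   -- Coprime (x-1) 2
      exact Nat.coprime_two_right.mpr hodd1
    have h2' : (x - 1) + 2 = x + 1 := by omega
    rwa [h2'] at h
  rw [hfac] at hdvd
  obtain ⟨t₁, t₂, ht, ht₁, ht₂⟩ := exists_fourthPow_split hcop hdvd
  obtain ⟨m₁, hm₁⟩ := ht₁
  obtain ⟨m₂, hm₂⟩ := ht₂
  -- positivity of `t`, `t₁`, `t₂` (if `t = 0` the cofactor hypothesis reads `0 ≤ B` but `t⁴ ∣ x² − 1 > 0` fails)
  have hpos : 0 < x ^ 2 - 1 := by rw [hfac]; exact Nat.mul_pos (by omega) (by omega)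
  have ht0 : 0 < t := by
    rcases Nat.eq_zero_or_pos t with h0 | h0
    · rw [h0] at hdvd; simp at hdvd; omega
    · exact h0
  have ht₂0 : 0 < t₂ := by
    rcases Nat.eq_zero_or_pos t₂ with h0 | h0
    · rw [h0, mul_zero] at ht; omega
    · exact h0
  -- the cofactor identity `m₁ m₂ = (x² − 1)/t⁴`
  have hprod : x ^ 2 - 1 = t ^ 4 * (m₁ * m₂) := by
    rw [hfac, hm₁, hm₂, ht]; ring
  have hm : m₁ * m₂ ≤ B := by
    have : (x ^ 2 - 1) / t ^ 4 = m₁ * m₂ := by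
      rw [hprod, Nat.mul_div_cancel_left _ (by positivity)]
    rwa [this] at hcof
  have hm₂0 : 0 < m₂ := by
    rcases Nat.eq_zero_or_pos m₂ with h0 | h0
    · rw [h0, mul_zero] at hm₂; omega
    · exact h0
  have hm₁0 : 0 < m₁ := by
    rcases Nat.eq_zero_or_pos m₁ with h0 | h0
    · rw [h0, mul_zero] at hm₁; omega
    · exact h0
  have hm₁B : m₁ ≤ max B 2 := (Nat.le_of_dvd (Nat.mul_pos hm₁0 hm₂0) ⟨m₂, rfl⟩).trans (hm.trans (le_max_left _ _))
  have hm₂B : m₂ ≤ max B 2 := (Nat.le_of_dvd (Nat.mul_pos hm₁0 hm₂0) ⟨m₁, by ring⟩).trans (hm.trans (le_max_left _ _))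
  -- the Thue equation `m₁ t₁⁴ + 2 = m₂ t₂⁴`
  have heq : m₁ * t₁ ^ 4 + 2 = m₂ * t₂ ^ 4 := by
    have h1 : x - 1 = m₁ * t₁ ^ 4 := by rw [hm₁]; ring
    have h3 : x + 1 = m₂ * t₂ ^ 4 := by rw [hm₂]; ring
    omega
  have ht₂N : t₂ ≤ N := hN m₁ m₂ 2 t₁ t₂ hm₁B hm₂B (by norm_num) (le_max_right _ _) heq
  -- conclude `x ≤ x + 1 = m₂ t₂⁴ ≤ max B 2 · N⁴`
  have hx1 : x + 1 = m₂ * t₂ ^ 4 := by rw [hm₂]; ring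
  calc x ≤ x + 1 := Nat.le_succ x
    _ = m₂ * t₂ ^ 4 := hx1
    _ ≤ max B 2 * N ^ 4 := Nat.mul_le_mul hm₂B (Nat.pow_le_pow_left ht₂N 4)

/-! ## All `x`: the odd case and the parity-free statement

For odd `x` the factors `x − 1`, `x + 1` have gcd `2`; one passes to the consecutive coprime pair
`a = (x − 1)/2`, `a + 1` with `x² − 1 = 4a(a+1)` and absorbs the `2`-part of `t` (`t` odd: `t⁴ ∣ a(a+1)`;
`t = 2t'`: `t'⁴ ∣ a(a+1)` with cofactor multiplied by `4`). -/

/-- **The odd case.** For every `B` there is `X₀(B)` such that for every ODD `x ≥ 2` and every `t` with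
`t⁴ ∣ x² − 1` and cofactor `(x² − 1)/t⁴ ≤ B` one has `x ≤ X₀`.  Here `x² − 1 = 4a(a+1)` with `a = (x−1)/2`,
and `a`, `a + 1` are coprime; for odd `t`, `t⁴ ∣ a(a+1)`, for even `t = 2t'`, `t'⁴ ∣ a(a+1)` — in both
cases a fourth power `T⁴ ∣ a(a+1)` with `t ≤ 2T` and cofactor `a(a+1)/T⁴ ≤ 4B`, which splits as
`a = m₁T₁⁴`, `a + 1 = m₂T₂⁴`, `m₁T₁⁴ + 1 = m₂T₂⁴`, `m₁m₂ ≤ 4B`; `binomialQuartic_bounded_box` bounds `T₂`.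
[cite: Roth1955] -/
theorem fourthPowerDivisor_cofactor_unbounded_odd (B : ℕ) :
    ∃ X₀ : ℕ, ∀ x t : ℕ, Odd x → 2 ≤ x → t ^ 4 ∣ x ^ 2 - 1 → (x ^ 2 - 1) / t ^ 4 ≤ B → x ≤ X₀ := by
  obtain ⟨N, hN⟩ := binomialQuartic_bounded_box (4 * B + 1)
  refine ⟨2 * ((4 * B + 1) * N ^ 4), fun x t hx h2 hdvd hcof => ?_⟩
  obtain ⟨a, ha⟩ := hx
  have ha1 : 1 ≤ a := by omega
  have hsq : x ^ 2 = 4 * (a * (a + 1)) + 1 := by rw [ha]; ring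
  have hfac : x ^ 2 - 1 = 4 * (a * (a + 1)) := by omega
  have hcop : Nat.Coprime a (a + 1) := by
    rw [Nat.coprime_self_add_right]; exact Nat.coprime_one_right a
  have hpos : 0 < x ^ 2 - 1 := by rw [hfac]; positivity
  have ht0 : 0 < t := by
    rcases Nat.eq_zero_or_pos t with h0 | h0
    · rw [h0] at hdvd; simp at hdvd; omega
    · exact h0
  rw [hfac] at hdvd hcof
  -- a fourth power `T⁴ ∣ a(a+1)` with cofactor `≤ 4B`
  have key : ∃ T : ℕ, 0 < T ∧ T ^ 4 ∣ a * (a + 1) ∧ a * (a + 1) / T ^ 4 ≤ 4 * B := by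
    rcases Nat.even_or_odd t with ht | ht
    · obtain ⟨t', ht'⟩ := ht
      have ht'2 : t = 2 * t' := by omega
      have ht'0 : 0 < t' := by omega
      have h16 : t ^ 4 = 4 * (4 * t' ^ 4) := by rw [ht'2]; ring
      rw [h16] at hdvd hcof
      have h4 : 4 * t' ^ 4 ∣ a * (a + 1) := Nat.dvd_of_mul_dvd_mul_left (by norm_num) hdvd
      obtain ⟨q, hq⟩ := h4
      refine ⟨t', ht'0, ⟨4 * q, by rw [hq]; ring⟩, ?_⟩
      have hq1 : a * (a + 1) / t' ^ 4 = 4 * q := by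
        rw [hq, show 4 * t' ^ 4 * q = t' ^ 4 * (4 * q) by ring, Nat.mul_div_cancel_left _ (by positivity)]
      have hq2 : 4 * (a * (a + 1)) / (4 * (4 * t' ^ 4)) = q := by
        rw [hq, show 4 * (4 * t' ^ 4 * q) = (4 * (4 * t' ^ 4)) * q by ring,
          Nat.mul_div_cancel_left _ (by positivity)]
      rw [hq2] at hcof
      omega
    · have hcop4 : Nat.Coprime (t ^ 4) 4 := by
        have h2 : Nat.Coprime t 2 := Nat.coprime_two_right.mpr ht
        simpa using (Nat.Coprime.pow 4 2 h2)
      have h4 : t ^ 4 ∣ a * (a + 1) := hcop4.dvd_of_dvd_mul_left hdvd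
      refine ⟨t, ht0, h4, ?_⟩
      calc a * (a + 1) / t ^ 4 ≤ 4 * (a * (a + 1)) / t ^ 4 := Nat.div_le_div_right (by omega)
        _ ≤ B := hcof
        _ ≤ 4 * B := by omega
  obtain ⟨T, hT0, hTdvd, hTcof⟩ := key
  obtain ⟨T₁, T₂, hT, hT₁, hT₂⟩ := exists_fourthPow_split hcop hTdvd
  obtain ⟨m₁, hm₁⟩ := hT₁
  obtain ⟨m₂, hm₂⟩ := hT₂
  have hT₂0 : 0 < T₂ := by
    rcases Nat.eq_zero_or_pos T₂ with h0 | h0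
    · rw [h0, mul_zero] at hT; omega
    · exact h0
  have hprod : a * (a + 1) = T ^ 4 * (m₁ * m₂) := by
    rw [hm₂, hm₁, hT]; ring
  have hm : m₁ * m₂ ≤ 4 * B := by
    have : a * (a + 1) / T ^ 4 = m₁ * m₂ := by
      rw [hprod, Nat.mul_div_cancel_left _ (by positivity)]
    rwa [this] at hTcof
  have hm₂0 : 0 < m₂ := by
    rcases Nat.eq_zero_or_pos m₂ with h0 | h0
    · rw [h0, mul_zero] at hm₂; omega
    · exact h0
  have hm₁0 : 0 < m₁ := by
    rcases Nat.eq_zero_or_pos m₁ with h0 | h0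
    · rw [h0, mul_zero] at hm₁; omega
    · exact h0
  have hm₁B : m₁ ≤ 4 * B + 1 :=
    ((Nat.le_of_dvd (Nat.mul_pos hm₁0 hm₂0) ⟨m₂, rfl⟩).trans hm).trans (Nat.le_succ _)
  have hm₂B : m₂ ≤ 4 * B + 1 :=
    ((Nat.le_of_dvd (Nat.mul_pos hm₁0 hm₂0) ⟨m₁, by ring⟩).trans hm).trans (Nat.le_succ _)
  have heq : m₁ * T₁ ^ 4 + 1 = m₂ * T₂ ^ 4 := by
    have h1 : a = m₁ * T₁ ^ 4 := by rw [hm₁]; ring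
    have h3 : a + 1 = m₂ * T₂ ^ 4 := by rw [hm₂]; ring
    omega
  have hT₂N : T₂ ≤ N := hN m₁ m₂ 1 T₁ T₂ hm₁B hm₂B one_pos (by omega) heq
  have ha2 : a + 1 = m₂ * T₂ ^ 4 := by rw [hm₂]; ring
  calc x = 2 * a + 1 := ha
    _ ≤ 2 * (a + 1) := by omega
    _ = 2 * (m₂ * T₂ ^ 4) := by rw [ha2]
    _ ≤ 2 * ((4 * B + 1) * N ^ 4) :=
        Nat.mul_le_mul_left 2 (Nat.mul_le_mul hm₂B (Nat.pow_le_pow_left hT₂N 4))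

/-- **`T(x² − 1) = o(√x)` (Roth stratum of `ConjP`, all `x`).** For every `B` there is an (ineffective)
`X₀(B)` such that `t⁴ ∣ x² − 1` with `x ≥ 2` and cofactor `(x² − 1)/t⁴ ≤ B` forces `x ≤ X₀`: along every
infinite family the cofactor of the largest fourth-power divisor of `x² − 1` tends to infinity, i.e.
`T(x² − 1)⁴ = o(x²)`.  Thue–Siegel–Roth, form by form (`fourthPowerDivisor_cofactor_unbounded_even` /
`_odd`); no rate — `ConjP` asks for `T(x² − 1) ≪_ε x^(1/3+ε)`. [cite: Roth1955] -/
theorem fourthPowerDivisor_cofactor_unbounded (B : ℕ) :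
    ∃ X₀ : ℕ, ∀ x t : ℕ, 2 ≤ x → t ^ 4 ∣ x ^ 2 - 1 → (x ^ 2 - 1) / t ^ 4 ≤ B → x ≤ X₀ := by
  obtain ⟨X₁, h₁⟩ := fourthPowerDivisor_cofactor_unbounded_even B
  obtain ⟨X₂, h₂⟩ := fourthPowerDivisor_cofactor_unbounded_odd B
  refine ⟨max X₁ X₂, fun x t hx hdvd hcof => ?_⟩
  rcases Nat.even_or_odd x with h | h
  · exact (h₁ x t h hx hdvd hcof).trans (le_max_left _ _)
  · exact (h₂ x t h hx hdvd hcof).trans (le_max_right _ _)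

end Summit.ABC.ABC.Theorems.UniformSadicTowerFour.FourthPowerDivisor
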